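import Mathlib
import Summits.PneNP.PneNP.Theorems.OverlapGapAlgebraSearchHardWindowVanishingRobust
import Literature.Computability.Complexity.RandomKSatLowDegreeHardness

/-!
# Route OverlapGapAlgebra, crux `SearchHardWindow` (stmt-PneNP-2460): vanishing success of
# low-degree maps under RANDOMISED ROUNDING (Huang–Sellke's `round_U`), unconditionally

Huang–Sellke 2025 (arXiv:2501.06427, p. 4 and Cor. 3.21) round a real output `x ∈ ℝⁿ` with random
thresholds: `round_U(x)_v = true` iff `x_v ≥ U_v`, `U ∼ Unif([-1,1]ⁿ)`, and prove
`P_{y,U}[round_U(A°(y)) satisfies y] = o(1)` for degree-`o(n)` `A°` of energy `O(n)` — with NO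
saturation proviso. The tree's named fact `HuangSellke2025KSat` records only the deterministic
saturated special case (`TODO(general form): randomized rounding round_U`). This file proves the
randomised-rounding form for degrees `o(n/log² n)`, unconditionally, with the thresholds drawn from
the uniform grid `U(u)_v = (2 u_v + 1)/R − 1`, `u : Fin n → Fin R` (any resolution `R ≥ R₀(k, ε)`):

**Theorem (`vanishingLowDegreeRounded`).** For `k ≥ k₀`, `C > 0`, `D_n = o(n/log² n)` and `ε > 0`
there is `R₀` such that eventually in `n`, for every `R ≥ R₀` and EVERY `F : instances → ℝⁿ` of
coordinate degree `≤ D_n` and energy `≤ C n · #Inst`,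
`#{(u, Φ) : round_{U(u)}(F(Φ)) satisfies Φ} ≤ ε · #Inst · Rⁿ`.
Proof: scale — `λ(F − U(u))` (`λ = ⌈4/(η₀ ε)⌉ + 1`) has degree `≤ D_n`, energy `≤ 2λ²(C+1) n · #Inst`, the
same signs as `round_{U(u)}(F)`, and is unsaturated exactly where `|F_v − U_v| < 1/λ`; by
`vanishingLowDegreeRobust` (threshold uniform in the map, hence in `u`) the pairs with `≤ η₀ n` such
coordinates contribute `≤ ε/2`, and by Markov over the grid (`vrd_card_grid_near_le`: at most
`R/λ + 1` grid values are `1/λ`-close to any real) the others contribute `≤ (1/λ + 1/R)/η₀ ≤ ε/2`.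

References: B. Huang, M. Sellke, arXiv:2501.06427, §1 p. 4, Cor. 3.21 [HuangSellke2025].
-/

namespace Summit.PneNP.PneNP.Theorems

set_option linter.dupNamespace false -- `Summit.PneNP.PneNP.…`: summit = sub-problem (D-0017)

open Finset Filter Asymptotics
open Literature.Computability.Complexity (IsCoordDegreeLE)
open scoped Classical

/-- At most `R δ + 1` points of the grid `(2t+1)/R − 1`, `t < R`, are `δ`-close to a given real. -/
theorem vrd_card_grid_near_le (R : ℕ) (hR : 1 ≤ R) (a δ : ℝ) (hδ : 0 < δ) :
    ((univ.filter fun t : Fin R => |a - ((2 * (t : ℕ) + 1 : ℝ) / R - 1)| < δ).card : ℝ) ≤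
      R * δ + 1 := by
  have hRpos : (0 : ℝ) < R := by exact_mod_cast hR
  set S : Finset (Fin R) := univ.filter fun t : Fin R => |a - ((2 * (t : ℕ) + 1 : ℝ) / R - 1)| < δ
    with hS
  rcases S.eq_empty_or_nonempty with hS0 | hSne
  · rw [hS0, card_empty, Nat.cast_zero]; positivity
  -- two close grid points have close indices
  have hclose : ∀ t ∈ S, ∀ t' ∈ S, ((t : ℕ) : ℝ) < (t' : ℕ) + R * δ := by
    intro t ht t' ht'
    simp only [hS, mem_filter, mem_univ, true_and] at ht ht'
    have h1 := (abs_lt.1 ht).1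
    have h2 := (abs_lt.1 ht').2
    have key : ((2 * (t : ℕ) + 1 : ℝ) / R) - ((2 * (t' : ℕ) + 1 : ℝ) / R) < 2 * δ := by linarith
    rw [← sub_div, div_lt_iff₀ hRpos] at key
    linarith
  obtain ⟨t₀, ht₀⟩ := hSne
  let tmin : Fin R := S.min' ⟨t₀, ht₀⟩
  have htmin : tmin ∈ S := S.min'_mem _
  -- `S` embeds into the integer interval `[tmin, tmin + ⌈R δ⌉)`
  have hsub : S.map Fin.valEmbedding ⊆ Finset.Ico (tmin : ℕ) ((tmin : ℕ) + ⌈(R : ℝ) * δ⌉₊) := by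
    intro x hx
    rw [Finset.mem_map] at hx
    obtain ⟨t, ht, rfl⟩ := hx
    rw [Finset.mem_Ico]
    constructor
    · exact_mod_cast S.min'_le t ht
    · have h := hclose t ht tmin htmin
      have h' : ((t : ℕ) : ℝ) < (tmin : ℕ) + ⌈(R : ℝ) * δ⌉₊ :=
        h.trans_le (by linarith [Nat.le_ceil ((R : ℝ) * δ)])
      exact_mod_cast h'
  calc (S.card : ℝ) = ((S.map Fin.valEmbedding).card : ℝ) := by rw [Finset.card_map]
    _ ≤ ((Finset.Ico (tmin : ℕ) ((tmin : ℕ) + ⌈(R : ℝ) * δ⌉₊)).card : ℝ) := by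
        exact_mod_cast Finset.card_le_card hsub
    _ = ⌈(R : ℝ) * δ⌉₊ := by rw [Nat.card_Ico, Nat.add_sub_cancel_left]
    _ ≤ R * δ + 1 := (Nat.ceil_lt_add_one (by positivity)).le

/-- **Vanishing success under randomised rounding (unconditional).** For `k ≥ k₀`, `C > 0`,
`D_n = o(n/log² n)` and `ε > 0` there is a resolution `R₀` such that, eventually in `n`
(`m = ⌊5·2^k log k/k · n⌋₊`), for every `R ≥ R₀` and every `F : instances → ℝⁿ` of coordinate
degree `≤ D_n` and energy `≤ C n · #Inst`, the pairs (threshold word `u : Fin n → Fin R`, instance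
`Φ`) for which the rounded assignment `v ↦ [F(Φ)_v ≥ (2u_v+1)/R − 1]` satisfies `Φ` number at most
`ε · #Inst · Rⁿ` — i.e. `P_{Φ,U}[round_U(F(Φ)) satisfies Φ] ≤ ε` for the grid-uniform threshold vector
`U`. [HuangSellke2025, Cor. 3.21] -/
theorem vanishingLowDegreeRounded :
    ∃ k₀ : ℕ, ∀ k : ℕ, k₀ ≤ k → ∀ C : ℝ, 0 < C → ∀ D : ℕ → ℕ,
      (fun n : ℕ => (D n : ℝ)) =o[atTop] (fun n : ℕ => (n : ℝ) / Real.log n ^ 2) →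
      ∀ ε : ℝ, 0 < ε → ∃ R₀ : ℕ, ∀ᶠ n : ℕ in atTop, ∀ m : ℕ, m = ⌊5 * 2 ^ k * Real.log k / k * n⌋₊ →
        ∀ R : ℕ, R₀ ≤ R → ∀ F : (Fin m → Fin k → Fin n × Bool) → Fin n → ℝ,
          (∀ v : Fin n, IsCoordDegreeLE (D n)
            (fun y : Fin m × Fin k → Fin n × Bool => F (Function.curry y) v)) →
          ∑ Φ : Fin m → Fin k → Fin n × Bool, ∑ v : Fin n, F Φ v ^ 2
              ≤ C * n * Fintype.card (Fin m → Fin k → Fin n × Bool) →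
          ((univ.filter fun p : (Fin n → Fin R) × (Fin m → Fin k → Fin n × Bool) =>
              ∀ i : Fin m, ∃ j : Fin k,
                decide ((2 * ((p.1 (p.2 i j).1 : ℕ) : ℝ) + 1) / R - 1 ≤ F p.2 (p.2 i j).1) =
                  (p.2 i j).2).card : ℝ)
            ≤ ε * Fintype.card (Fin m → Fin k → Fin n × Bool) * Fintype.card (Fin n → Fin R) := by
  obtain ⟨k₀, hk₀⟩ := vanishingLowDegreeRobust
  refine ⟨k₀, fun k hk C hC D hD ε hε => ?_⟩
  obtain ⟨η₀, hη₀, hrob⟩ := hk₀ k hk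
  -- the scaling `λ` and the resolution threshold
  set lam : ℕ := ⌈4 / (η₀ * ε)⌉₊ + 1 with hlam
  have hlam1 : (1 : ℝ) ≤ lam := by rw [hlam]; exact_mod_cast Nat.le_add_left 1 _
  have hlampos : (0 : ℝ) < lam := by linarith
  have hlamge : 4 / (η₀ * ε) ≤ lam := by
    rw [hlam]; push_cast; linarith [Nat.le_ceil (4 / (η₀ * ε))]
  refine ⟨lam, ?_⟩
  have h := hrob (2 * (lam : ℝ) ^ 2 * (C + 1)) (by positivity) D hD (ε / 2) (half_pos hε)
  filter_upwards [h, eventually_ge_atTop 1] with n hn hn1 m hm R hR F hdeg hener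
  have hnpos : (0 : ℝ) < n := by exact_mod_cast hn1
  have hR1 : 1 ≤ R := le_trans (by rw [hlam]; omega) hR
  have hRpos : (0 : ℝ) < R := by exact_mod_cast hR1
  have hRge : 4 / (η₀ * ε) ≤ R := hlamge.trans (by exact_mod_cast hR)
  haveI : Nonempty (Fin n × Bool) := ⟨(⟨0, hn1⟩, true)⟩
  set Q : ℝ := (Fintype.card (Fin m → Fin k → Fin n × Bool) : ℝ) with hQ
  have hQpos : 0 < Q := by rw [hQ]; exact_mod_cast Fintype.card_pos
  set W : ℝ := (Fintype.card (Fin n → Fin R) : ℝ) with hW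
  have hW0 : 0 ≤ W := Nat.cast_nonneg _
  -- the thresholds and the scaled maps
  set U : (Fin n → Fin R) → Fin n → ℝ := fun u v => (2 * ((u v : ℕ) : ℝ) + 1) / R - 1 with hU
  have hUle : ∀ u v, |U u v| ≤ 1 := by
    intro u v
    have ht : ((u v : ℕ) : ℝ) + 1 ≤ R := by exact_mod_cast (u v).isLt
    have ht0 : (0 : ℝ) ≤ (u v : ℕ) := Nat.cast_nonneg _
    rw [hU, abs_le]
    constructor
    · have : 0 ≤ (2 * ((u v : ℕ) : ℝ) + 1) / R := by positivity
      linarith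
    · have : (2 * ((u v : ℕ) : ℝ) + 1) / R ≤ 2 := by
        rw [div_le_iff₀ hRpos]; linarith
      linarith
  set Fs : (Fin n → Fin R) → (Fin m → Fin k → Fin n × Bool) → Fin n → ℝ :=
    fun u Φ v => lam * (F Φ v - U u v) with hFs
  -- their degree and energy
  have hdegs : ∀ u v, IsCoordDegreeLE (D n)
      (fun y : Fin m × Fin k → Fin n × Bool => Fs u (Function.curry y) v) := by
    intro u v
    have h1 := ((hdeg v).add (IsCoordDegreeLE.const (D n) (-(U u v)))).smul (lam : ℝ)
    refine (congrArg (IsCoordDegreeLE (D n)) ?_).mp h1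
    funext y
    simp only [hFs]
    ring
  have heners : ∀ u, ∑ Φ : Fin m → Fin k → Fin n × Bool, ∑ v : Fin n, Fs u Φ v ^ 2 ≤
      2 * (lam : ℝ) ^ 2 * (C + 1) * n * Fintype.card (Fin m → Fin k → Fin n × Bool) := by
    intro u
    have hpt : ∀ (Φ : Fin m → Fin k → Fin n × Bool) (v : Fin n),
        Fs u Φ v ^ 2 ≤ 2 * (lam : ℝ) ^ 2 * (F Φ v ^ 2 + 1) := by
      intro Φ v
      simp only [hFs]
      have hU1 := hUle u v
      have hU2 : U u v ^ 2 ≤ 1 := by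
        have := abs_le.1 hU1
        nlinarith
      nlinarith [sq_nonneg (F Φ v + U u v), sq_nonneg (lam : ℝ), hU2,
        mul_nonneg (sq_nonneg (lam : ℝ)) (sq_nonneg (F Φ v + U u v))]
    calc ∑ Φ : Fin m → Fin k → Fin n × Bool, ∑ v : Fin n, Fs u Φ v ^ 2
        ≤ ∑ Φ : Fin m → Fin k → Fin n × Bool, ∑ v : Fin n, 2 * (lam : ℝ) ^ 2 * (F Φ v ^ 2 + 1) :=
          Finset.sum_le_sum fun Φ _ => Finset.sum_le_sum fun v _ => hpt Φ v
      _ = 2 * (lam : ℝ) ^ 2 * (∑ Φ : Fin m → Fin k → Fin n × Bool, ∑ v : Fin n, F Φ v ^ 2 + n * Q) := by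
          rw [hQ]
          simp only [Finset.mul_sum, Finset.sum_add_distrib, Finset.sum_const, Finset.card_univ,
            Fintype.card_fin, nsmul_eq_mul, mul_add, mul_one]
          ring
      _ ≤ 2 * (lam : ℝ) ^ 2 * (C * n * Q + n * Q) := by gcongr
      _ = 2 * (lam : ℝ) ^ 2 * (C + 1) * n * Fintype.card (Fin m → Fin k → Fin n × Bool) := by
          rw [hQ]; ring
  -- the robust theorem, for every threshold word
  have hgood : ∀ u, ((univ.filter fun Φ : Fin m → Fin k → Fin n × Bool =>
      ((univ.filter fun v : Fin n => |Fs u Φ v| < 1).card : ℝ) ≤ η₀ * n ∧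
      ∀ i : Fin m, ∃ j : Fin k, decide (0 ≤ Fs u Φ (Φ i j).1) = (Φ i j).2).card : ℝ) ≤ ε / 2 * Q :=
    fun u => hn m hm (Fs u) (hdegs u) (heners u)
  -- rounding with the threshold word `u` is the sign of the scaled map
  have hsign : ∀ u (Φ : Fin m → Fin k → Fin n × Bool) (v : Fin n),
      decide (0 ≤ Fs u Φ v) = decide (U u v ≤ F Φ v) := by
    intro u Φ v
    simp only [hFs]
    by_cases hc : U u v ≤ F Φ v
    · rw [decide_eq_true hc, decide_eq_true (mul_nonneg hlampos.le (by linarith))]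
    · rw [decide_eq_false hc, decide_eq_false]
      push Not at hc ⊢
      exact mul_neg_of_pos_of_neg hlampos (by linarith)
  -- unsaturated coordinates of the scaled map are the near-threshold ones
  have hunsat : ∀ u (Φ : Fin m → Fin k → Fin n × Bool),
      (univ.filter fun v : Fin n => |Fs u Φ v| < 1) =
        univ.filter fun v : Fin n => |F Φ v - U u v| < 1 / lam := by
    intro u Φ
    refine Finset.filter_congr fun v _ => ?_
    simp only [hFs, abs_mul, abs_of_pos hlampos]
    rw [lt_div_iff₀ hlampos, mul_comm]
  -- split the success pairs into robust-good ones and near-threshold-heavy ones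
  set near : (Fin n → Fin R) × (Fin m → Fin k → Fin n × Bool) → ℕ := fun p =>
    (univ.filter fun v : Fin n => |F p.2 v - U p.1 v| < 1 / lam).card with hnear
  have hsplit : (univ.filter fun p : (Fin n → Fin R) × (Fin m → Fin k → Fin n × Bool) =>
      ∀ i : Fin m, ∃ j : Fin k, decide (U p.1 (p.2 i j).1 ≤ F p.2 (p.2 i j).1) = (p.2 i j).2).card ≤
      (univ.filter fun p : (Fin n → Fin R) × (Fin m → Fin k → Fin n × Bool) =>
        (∀ i : Fin m, ∃ j : Fin k, decide (U p.1 (p.2 i j).1 ≤ F p.2 (p.2 i j).1) = (p.2 i j).2) ∧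
          (near p : ℝ) ≤ η₀ * n).card +
      (univ.filter fun p : (Fin n → Fin R) × (Fin m → Fin k → Fin n × Bool) =>
        ¬ (near p : ℝ) ≤ η₀ * n).card := by
    refine (Finset.card_le_card fun p hp => ?_).trans (Finset.card_union_le _ _)
    simp only [Finset.mem_filter, Finset.mem_univ, true_and, Finset.mem_union] at hp ⊢
    by_cases hq : (near p : ℝ) ≤ η₀ * n
    · exact Or.inl ⟨hp, hq⟩
    · exact Or.inr hq
  -- (a) the robust-good pairs: sum over `u` of the robust bound
  have hA : ((univ.filter fun p : (Fin n → Fin R) × (Fin m → Fin k → Fin n × Bool) =>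
      (∀ i : Fin m, ∃ j : Fin k, decide (U p.1 (p.2 i j).1 ≤ F p.2 (p.2 i j).1) = (p.2 i j).2) ∧
        (near p : ℝ) ≤ η₀ * n).card : ℝ) ≤ ε / 2 * Q * W := by
    have hre : ((univ.filter fun p : (Fin n → Fin R) × (Fin m → Fin k → Fin n × Bool) =>
        (∀ i : Fin m, ∃ j : Fin k, decide (U p.1 (p.2 i j).1 ≤ F p.2 (p.2 i j).1) = (p.2 i j).2) ∧
          (near p : ℝ) ≤ η₀ * n).card : ℝ) =
        ∑ u : Fin n → Fin R, ((univ.filter fun Φ : Fin m → Fin k → Fin n × Bool =>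
          ((univ.filter fun v : Fin n => |Fs u Φ v| < 1).card : ℝ) ≤ η₀ * n ∧
          ∀ i : Fin m, ∃ j : Fin k, decide (0 ≤ Fs u Φ (Φ i j).1) = (Φ i j).2).card : ℝ) := by
      rw [Finset.card_filter, Nat.cast_sum, Fintype.sum_prod_type]
      refine Finset.sum_congr rfl fun u _ => ?_
      rw [Finset.card_filter, Nat.cast_sum]
      refine Finset.sum_congr rfl fun Φ _ => ?_
      simp only [hsign, hunsat, hnear, and_comm]
    rw [hre]
    calc ∑ u : Fin n → Fin R, ((univ.filter fun Φ : Fin m → Fin k → Fin n × Bool =>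
          ((univ.filter fun v : Fin n => |Fs u Φ v| < 1).card : ℝ) ≤ η₀ * n ∧
          ∀ i : Fin m, ∃ j : Fin k, decide (0 ≤ Fs u Φ (Φ i j).1) = (Φ i j).2).card : ℝ)
        ≤ ∑ _u : Fin n → Fin R, ε / 2 * Q := Finset.sum_le_sum fun u _ => hgood u
      _ = ε / 2 * Q * W := by rw [Finset.sum_const, Finset.card_univ, nsmul_eq_mul, hW]; ring
  -- (b) the near-threshold-heavy pairs: Markov over the grid
  have hB : ((univ.filter fun p : (Fin n → Fin R) × (Fin m → Fin k → Fin n × Bool) =>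
      ¬ (near p : ℝ) ≤ η₀ * n).card : ℝ) ≤ ε / 2 * Q * W := by
    -- Markov
    have hM : ((univ.filter fun p : (Fin n → Fin R) × (Fin m → Fin k → Fin n × Bool) =>
        ¬ (near p : ℝ) ≤ η₀ * n).card : ℝ) * (η₀ * n) ≤ ∑ p, (near p : ℝ) := by
      rw [Finset.card_filter, Nat.cast_sum, Finset.sum_mul]
      refine Finset.sum_le_sum fun p _ => ?_
      split_ifs with hp
      · push_cast; rw [zero_mul]; exact Nat.cast_nonneg _
      · push_cast; rw [one_mul]; exact (not_le.1 hp).le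
    -- the total near-threshold count: swap the sums and count grid points
    have hT : ∑ p : (Fin n → Fin R) × (Fin m → Fin k → Fin n × Bool), (near p : ℝ) ≤
        Q * n * (W * (1 / lam + 1 / R)) := by
      have hcount : ∀ (Φ : Fin m → Fin k → Fin n × Bool) (v : Fin n),
          ((univ.filter fun u : Fin n → Fin R => |F Φ v - U u v| < 1 / lam).card : ℝ) ≤
            W * (1 / lam + 1 / R) := by
        intro Φ v
        -- the condition only involves the coordinate `u v`
        have hre : (univ.filter fun u : Fin n → Fin R => |F Φ v - U u v| < 1 / lam).card =
            (univ.filter fun t : Fin R => |F Φ v - ((2 * (t : ℕ) + 1 : ℝ) / R - 1)| < 1 / lam).card *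
              Fintype.card ({w : Fin n // w ≠ v} → Fin R) := by
          rw [← Finset.card_univ (α := {w : Fin n // w ≠ v} → Fin R), ← Finset.card_product]
          refine Finset.card_equiv (Equiv.funSplitAt v (Fin R)) fun u => ?_
          simp only [mem_filter, mem_univ, true_and, Finset.mem_product, and_true, hU,
            Equiv.funSplitAt_apply]
        have hWsplit : W = R * Fintype.card ({w : Fin n // w ≠ v} → Fin R) := by
          rw [hW, Fintype.card_congr (Equiv.funSplitAt v (Fin R)), Fintype.card_prod,
            Fintype.card_fin]
          push_cast; ring
        have hgrid := vrd_card_grid_near_le R hR1 (F Φ v) (1 / lam) (by positivity)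
        have hrest : (0 : ℝ) ≤ Fintype.card ({w : Fin n // w ≠ v} → Fin R) := Nat.cast_nonneg _
        rw [hre, Nat.cast_mul, hWsplit]
        calc ((univ.filter fun t : Fin R =>
              |F Φ v - ((2 * (t : ℕ) + 1 : ℝ) / R - 1)| < 1 / lam).card : ℝ) *
              Fintype.card ({w : Fin n // w ≠ v} → Fin R)
            ≤ (R * (1 / lam) + 1) * Fintype.card ({w : Fin n // w ≠ v} → Fin R) :=
              mul_le_mul_of_nonneg_right hgrid hrest
          _ = R * Fintype.card ({w : Fin n // w ≠ v} → Fin R) * (1 / lam + 1 / R) := by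
              field_simp
      calc ∑ p : (Fin n → Fin R) × (Fin m → Fin k → Fin n × Bool), (near p : ℝ)
          = ∑ Φ : Fin m → Fin k → Fin n × Bool, ∑ u : Fin n → Fin R, (near (u, Φ) : ℝ) := by
            rw [Fintype.sum_prod_type, Finset.sum_comm]
        _ = ∑ Φ : Fin m → Fin k → Fin n × Bool, ∑ v : Fin n,
              ((univ.filter fun u : Fin n → Fin R => |F Φ v - U u v| < 1 / lam).card : ℝ) := by
            refine Finset.sum_congr rfl fun Φ _ => ?_
            simp only [hnear, Finset.card_filter, Nat.cast_sum]
            rw [Finset.sum_comm]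
        _ ≤ ∑ Φ : Fin m → Fin k → Fin n × Bool, ∑ _v : Fin n, W * (1 / lam + 1 / R) :=
            Finset.sum_le_sum fun Φ _ => Finset.sum_le_sum fun v _ => hcount Φ v
        _ = Q * n * (W * (1 / lam + 1 / R)) := by
            simp only [Finset.sum_const, Finset.card_univ, Fintype.card_fin, nsmul_eq_mul, hQ]
            ring
    -- `(1/λ + 1/R)/η₀ ≤ ε/2`
    have hsmall : (1 / (lam : ℝ) + 1 / R) ≤ η₀ * ε / 2 := by
      have h1 : 1 / (lam : ℝ) ≤ η₀ * ε / 4 := by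
        rw [div_le_iff₀ hlampos]
        have := mul_le_mul_of_nonneg_left hlamge (by positivity : (0 : ℝ) ≤ η₀ * ε / 4)
        have h' : η₀ * ε / 4 * (4 / (η₀ * ε)) = 1 := by field_simp
        linarith
      have h2 : 1 / (R : ℝ) ≤ η₀ * ε / 4 := by
        rw [div_le_iff₀ hRpos]
        have := mul_le_mul_of_nonneg_left hRge (by positivity : (0 : ℝ) ≤ η₀ * ε / 4)
        have h' : η₀ * ε / 4 * (4 / (η₀ * ε)) = 1 := by field_simp
        linarith
      linarith
    have hηn : 0 < η₀ * n := by positivity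
    rw [← mul_le_mul_iff_left₀ hηn]
    calc ((univ.filter fun p : (Fin n → Fin R) × (Fin m → Fin k → Fin n × Bool) =>
          ¬ (near p : ℝ) ≤ η₀ * n).card : ℝ) * (η₀ * n)
        ≤ Q * n * (W * (1 / lam + 1 / R)) := hM.trans hT
      _ ≤ Q * n * (W * (η₀ * ε / 2)) := by gcongr
      _ = ε / 2 * Q * W * (η₀ * n) := by ring
  -- conclusion
  have hfin : ((univ.filter fun p : (Fin n → Fin R) × (Fin m → Fin k → Fin n × Bool) =>
      ∀ i : Fin m, ∃ j : Fin k, decide (U p.1 (p.2 i j).1 ≤ F p.2 (p.2 i j).1) = (p.2 i j).2).card : ℝ)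
      ≤ ε / 2 * Q * W + ε / 2 * Q * W := by
    have h' := (Nat.cast_le (α := ℝ)).2 hsplit
    push_cast at h'
    exact h'.trans (add_le_add hA hB)
  simp only [hU] at hfin
  rw [hW] at hfin
  linarith

end Summit.PneNP.PneNP.Theorems
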